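import Summits.AtomisticToContinuum.Crystallization.Theorems.ReggeStarCoercivityStabilityConstantTwelveNegCert

/-!
# Route `ReggeStarCoercivity`, crux `StabilityConstantTwelve` (stmt-AtomisticToContinuum-13601) —
# negative side III-a: block sums and the 409-row `D₄` certificate data

Supporting file for the CLOSED item stmt-AtomisticToContinuum-13601.  Port into `Theorems/` (LEAN-IN-TREE
rule, 2026-08-18) of the disprover's crux companion
`Summits/AtomisticToContinuum/Crystallization/Cruxes/StabilityConstantTwelve/DisproofHeavyD4.lean`
(namespace `….Cruxes.StabilityConstantTwelve.Disproof.HeavyD4`, 2026-08-16; verbatim), over the evaluation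
machine `Cert.*` of `…NegCert.lean`: the block sum `Cert.hsumB` (lets a long certificate be split over
several declarations / modules, each within a per-module kernel budget) and the rows `d4Rows` of the
`D₄` ball `{v ∈ ℤ⁴ : ∑ vᵢ even, |v|² ≤ 12}` (409 points, translated by `(3,3,3,3)`).  The five kernel-decided
blocks are `…NegDFourBlock0.lean` … `…NegDFourBlock4.lean`; the bound `E_{ℝ⁴}(409) ≤ -420` and the dimension
threshold are assembled in `…NegDFour.lean`.
-/

noncomputable section

namespace Summit.AtomisticToContinuum.Crystallization.Theorems.StabilityConstantTwelveNegative

open Literature.MathematicalPhysics.StatisticalMechanics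

namespace Cert

/-- partial sum over a BLOCK of rows `B` against all rows of `L` (lets a long certificate be
split over several declarations, each within a per-declaration kernel budget).
[port of `…Cruxes.StabilityConstantTwelve.Disproof.HeavyD4.Cert.hsumB`] -/
def hsumB (B L : List (List ℕ)) (s : ℚ) : ℚ :=
  (B.map fun u => ((rowHist L u).map fun p => (p.2 : ℚ) * Wq (s * p.1)).sum).sum

/-- the whole-certificate sum is the block sum of all rows. -/
theorem hsum_eq_hsumB (L : List (List ℕ)) (s : ℚ) : hsum L s = hsumB L L s := rfl

/-- block sums are additive in the block. -/
theorem hsumB_append (B₁ B₂ L : List (List ℕ)) (s : ℚ) :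
    hsumB (B₁ ++ B₂) L s = hsumB B₁ L s + hsumB B₂ L s := by
  simp [hsumB, List.map_append, List.sum_append]

/-- first block. -/
theorem hsumB_split (B L : List (List ℕ)) (s : ℚ) (n : ℕ) :
    hsumB B L s = hsumB (B.take n) L s + hsumB (B.drop n) L s := by
  conv_lhs => rw [← List.take_append_drop n B]
  rw [hsumB_append]

/-- peel the next block of `n` rows off `L.drop a`. -/
theorem hsumB_drop_split (B L : List (List ℕ)) (s : ℚ) (a n : ℕ) :
    hsumB (B.drop a) L s = hsumB ((B.drop a).take n) L s + hsumB (B.drop (a + n)) L s := by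
  conv_lhs => rw [← List.take_append_drop n (B.drop a)]
  rw [hsumB_append, List.drop_drop]

end Cert

open Cert

/-- `D₄` ball `|v|² ≤ 12` (translated by `(3,3,3,3)`): 409 rows. [port of `…Cruxes.StabilityConstantTwelve.Disproof.HeavyD4.d4Rows`] -/
def d4Rows : List (List ℕ) := dBall 4 3 12

end Summit.AtomisticToContinuum.Crystallization.Theorems.StabilityConstantTwelveNegative

end
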